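import Literature.Barriers.SmoothPoincare4.ExoticContractibleTheoremAProofs
import Literature.Topology.FourManifolds.CobordismBoundaryData
import Literature.AlgebraicTopology.Homotopy.CollarGluing
import Literature.AlgebraicTopology.Homotopy.WhiteheadContractibleProofs
import Literature.AlgebraicTopology.SingularHomology.DisjointUnion
import Literature.AlgebraicTopology.SingularHomology.CapProduct
import HarnessLib

/-!
# Proof architecture of Akbulut–Ruberman's symmetry-killing cobordism: the gluing is contractible

Third-level sibling proof file of `Literature/Barriers/SmoothPoincare4/ExoticContractible.lean`,
under `ExoticContractibleTheoremAProofs.lean`. That file isolates, as the deep leaf of the printed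
proof of Akbulut–Ruberman's Thm. A (S. Akbulut, D. Ruberman, *Absolutely exotic compact
4-manifolds*, Comment. Math. Helv. 91 (2016) 1–19, §3), the named fact
`Literature.Barriers.SmoothPoincare4.akbulutRuberman2016_symmetryKillingCobordism` — for a compact
contractible `W` with `M = ∂W` there is a cobordism `X` from `M` to some `N` which is (i) invertible,
(ii) has the extension property of the Claim of §3, and (iii) makes every `V = W ∪_ψ X`
contractible. Of its printed ingredients only (iii) has vocabulary in the tree: it is the sentence
"Since `V` and `V′` are simply connected homology balls, they are contractible" (§3), resting on
Lemma 2.3 ("`X` is an invertible homology cobordism from `M` to a 3-manifold `N` … the inclusion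
`M → X` induces an isomorphism on fundamental groups") through van Kampen's theorem,
Mayer–Vietoris and the Hurewicz–Whitehead recognition of contractible manifolds. This file PROVES
that step and thereby reduces the named fact to its geometric core (Lemma 2.3 with Cor. 2.5 and
Prop. 2.6, and the Claim — hyperbolic 3-manifolds with trivial symmetry group, JSJ decompositions,
the doubly slice knot `11n42`; no vocabulary in Mathlib or the tree):

* `Literature.Barriers.SmoothPoincare4.contractibleSpace_of_cobordismAttachment` — **`W ∪_ψ X` is
  contractible** whenever `W` is a compact contractible smooth manifold with connected boundary
  `M`, `X` is a cobordism from `M` to a compact `N ≠ ∅` with `M → X` an integral homology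
  isomorphism and `π₁(M) → π₁(X)` onto, `ψ` is any self-diffeomorphism of `M`, and `V`
  is ANY Hausdorff witness of the attachment (`CobordismAttachment b X ψ V`, merely
  `ChartedSpace`). All dimensions.
* `Literature.Barriers.SmoothPoincare4.akbulutRuberman2016_symmetryKillingCobordism_of_core` —
  the named fact from its geometric core, stated inline (no new named fact is introduced,
  D-0026): for every compact contractible `W`, `∂W` is connected and there is a cobordism `X` from
  `∂W` to a closed `N ≠ ∅`, invertible, with the extension property of the Claim, with `∂W → X` a
  homology isomorphism and `π₁`-surjective.

## Proof of `contractibleSpace_of_cobordismAttachment`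

1. (`seamCollar`, `gluingData`) A long open collar of the incoming end `M` of `X`
   (`Cobordism.nonempty_inlOpenCollar`, `CobordismBoundaryData.lean`), precomposed with `ψ`,
   is a topological boundary collar `κ` of `X` parametrised by `M` with `κ (z, 0) = X.inl (ψ z)`,
   and `V` is the gluing of `W` (along `b.incl`) and `X` (along the bottom of `κ`) in the sense of
   `Literature.AlgebraicTopology.Homotopy.BoundaryCollar.GluingData` (`CollarGluing.lean`): the
   seam relation is the field `jW_eq_jX_iff` of the attachment.
2. (`simplyConnectedSpace_of_cobordismAttachment`, `isZero_singularHomology_of_cobordismAttachment`)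
   Hence `V` is simply connected (van Kampen) and `Hₖ(V; ℤ) = 0` for `k ≥ 1` (Mayer–Vietoris), by
   the theorems of `CollarGluing.lean`, the hypotheses on `X.inl` being transported along `ψ`;
   `X` itself is path connected because `H₀(∂W) → H₀(X)` is onto
   (`pathConnectedSpace_of_surjective_singularHomologyMap_zero`, Hatcher Prop. 2.6/2.7).
3. (`farCollar`, `interiorChartedSpace`) A long open collar of the far end `N` (the incoming end
   of `X.symm`), pushed into `V` by `jX`, is a boundary collar of `V` whose bottom is
   `∂V = jX (X.inr N)`; so the interior `V ∖ ∂V` is OPEN and a deformation retract of `V`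
   (`BoundaryCollar.interiorHomotopyEquiv`, `CollarPush.lean`), and it is a boundaryless
   topological manifold: the charts of `V` at interior points, cut down to the open half-space
   and to the (open) interior, are charts valued in `ℝⁿ⁺¹` — no invariance of domain is needed
   because the interior is known to be open.
4. The interior is then a simply connected, acyclic, Hausdorff, second countable topological
   manifold, hence contractible (Bredon, *Topology and Geometry* (1993), VII Cor. 10.11 — the
   tree's PROVED `Manifold.contractibleSpace_of_simplyConnected_of_acyclic_holds`,
   `WhiteheadContractibleProofs.lean`), and so is `V ≃ V ∖ ∂V`.

## References

* S. Akbulut, D. Ruberman, *Absolutely exotic compact 4-manifolds*, Comment. Math. Helv. 91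
  (2016) 1–19 = arXiv:1410.1461v3, Lemma 2.3 and §3 (proof of Thm. A). [AkbulutRuberman2016]
* A. Hatcher, *Algebraic Topology*, CUP (2002), Thm. 1.20 (van Kampen), §2.2 p. 149
  (Mayer–Vietoris), Prop. 3.42 (collars), Cor. 4.33. [HatcherAT2002]
* G. E. Bredon, *Topology and Geometry*, GTM 139 (1993), Ch. VII Cor. 10.11. [Bredon1993]
* J. Milnor, *Lectures on the h-cobordism theorem*, Princeton (1965), §1, Thm. 1.4.
  [MilnorHCobordism1965]
-/

noncomputable section

open scoped Manifold ContDiff Topology unitInterval ContinuousMap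
open Function Set CategoryTheory CategoryTheory.Limits
open Literature.Topology.FourManifolds Literature.AlgebraicTopology.Homotopy
  Literature.AlgebraicTopology.SingularHomology

namespace Literature.Barriers.SmoothPoincare4

universe u

/-- Local notation: `𝔼 n` is the model Euclidean space `EuclideanSpace ℝ (Fin n)`. -/
local notation "𝔼 " n:arg => EuclideanSpace ℝ (Fin n)

/-- Local notation: `ℍ n` is the closed half space `EuclideanHalfSpace n`. -/
local notation "ℍ " n:arg => EuclideanHalfSpace n

/-! ### The interior of a topological manifold with boundary, when it is known to be open -/

section Interior

variable {n : ℕ} {V : Type u} [TopologicalSpace V] [ChartedSpace (ℍ (n + 1)) V]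

open Classical in
/-- **Charts of the interior `V ∖ ∂V` of a topological manifold with boundary, modelled on
`ℝⁿ⁺¹`, when the interior is known to be open.** At an interior point `p` (Mathlib's
`(𝓡∂ (n + 1)).interior V`: the preferred chart sends `p` into the open half-space): the extended
chart `extChartAt (𝓡∂ (n + 1)) p` of `V`, cut down to the preimage of the interior of its target
AND of the interior of `V`, as an open partial homeomorphism of the subspace `V ∖ ∂V` into
`ℝⁿ⁺¹` (junk value `p` of the inverse off the target). For `C¹` manifolds the second cut is
superfluous (smooth invariance of the boundary; the tree's `ManifoldInterior.interiorChart`,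
`ClosedModelCharts.lean`); for merely topological charts it replaces invariance of domain, at the
price of the openness hypothesis `hO`. Hatcher, *Algebraic Topology* (2002), §3.3, p. 252
("`M ∖ ∂M` is an `n`-manifold"). [cite: HatcherAT2002, §3.3, p. 252] -/
def interiorChartOfIsOpen (hO : IsOpen ((𝓡∂ (n + 1)).interior V))
    (p : ↥((𝓡∂ (n + 1)).interior V)) :
    OpenPartialHomeomorph ↥((𝓡∂ (n + 1)).interior V) (𝔼 (n + 1)) where
  toFun q := extChartAt (𝓡∂ (n + 1)) p.1 q.1
  invFun y := if h : y ∈ interior (extChartAt (𝓡∂ (n + 1)) p.1).target ∩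
      (extChartAt (𝓡∂ (n + 1)) p.1).symm ⁻¹' (𝓡∂ (n + 1)).interior V then
      ⟨(extChartAt (𝓡∂ (n + 1)) p.1).symm y, h.2⟩
    else p
  source := Subtype.val ⁻¹' ((extChartAt (𝓡∂ (n + 1)) p.1).source ∩
      extChartAt (𝓡∂ (n + 1)) p.1 ⁻¹' (interior (extChartAt (𝓡∂ (n + 1)) p.1).target ∩
        (extChartAt (𝓡∂ (n + 1)) p.1).symm ⁻¹' (𝓡∂ (n + 1)).interior V))
  target := interior (extChartAt (𝓡∂ (n + 1)) p.1).target ∩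
      (extChartAt (𝓡∂ (n + 1)) p.1).symm ⁻¹' (𝓡∂ (n + 1)).interior V
  map_source' := by
    rintro q ⟨-, hq⟩
    exact hq
  map_target' := by
    intro y hy
    rw [dif_pos hy]
    refine ⟨(extChartAt (𝓡∂ (n + 1)) p.1).map_target (interior_subset hy.1), ?_⟩
    show extChartAt (𝓡∂ (n + 1)) p.1 ((extChartAt (𝓡∂ (n + 1)) p.1).symm y) ∈
      interior (extChartAt (𝓡∂ (n + 1)) p.1).target ∩
        (extChartAt (𝓡∂ (n + 1)) p.1).symm ⁻¹' (𝓡∂ (n + 1)).interior V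
    rw [(extChartAt (𝓡∂ (n + 1)) p.1).right_inv (interior_subset hy.1)]
    exact hy
  left_inv' := by
    rintro q ⟨hq₁, hq₂⟩
    rw [mem_preimage] at hq₂
    rw [dif_pos hq₂]
    exact Subtype.ext ((extChartAt (𝓡∂ (n + 1)) p.1).left_inv hq₁)
  right_inv' := by
    intro y hy
    rw [dif_pos hy]
    exact (extChartAt (𝓡∂ (n + 1)) p.1).right_inv (interior_subset hy.1)
  open_source := by
    refine (isOpen_extChartAt_preimage' p.1 ?_).preimage continuous_subtype_val
    exact ((continuousOn_extChartAt_symm p.1).mono interior_subset).isOpen_inter_preimage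
      isOpen_interior hO
  open_target := ((continuousOn_extChartAt_symm p.1).mono interior_subset).isOpen_inter_preimage
    isOpen_interior hO
  continuousOn_toFun := by
    refine (continuousOn_extChartAt p.1).comp continuous_subtype_val.continuousOn ?_
    rintro q ⟨hq, -⟩
    exact hq
  continuousOn_invFun := by
    refine (Topology.IsInducing.subtypeVal.continuousOn_iff).2
      (((continuousOn_extChartAt_symm p.1).mono fun y hy => interior_subset hy.1).congr ?_)
    intro y hy
    rw [Function.comp_apply, dif_pos hy]

/-- An interior point lies in the source of its interior chart. [folklore] -/
theorem mem_interiorChartOfIsOpen_source (hO : IsOpen ((𝓡∂ (n + 1)).interior V))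
    (p : ↥((𝓡∂ (n + 1)).interior V)) : p ∈ (interiorChartOfIsOpen hO p).source := by
  refine ⟨mem_extChartAt_source p.1, ?_⟩
  rw [mem_preimage]
  refine ⟨(𝓡∂ (n + 1)).isInteriorPoint_iff.1 p.2, ?_⟩
  rw [mem_preimage, (extChartAt (𝓡∂ (n + 1)) p.1).left_inv (mem_extChartAt_source p.1)]
  exact p.2

/-- **The interior of a topological manifold with boundary is a boundaryless topological
manifold** (charts `interiorChartOfIsOpen`), given that the interior is open.
[cite: HatcherAT2002, §3.3, p. 252] -/
@[reducible] def interiorChartedSpace (hO : IsOpen ((𝓡∂ (n + 1)).interior V)) :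
    ChartedSpace (𝔼 (n + 1)) ↥((𝓡∂ (n + 1)).interior V) where
  atlas := range (interiorChartOfIsOpen hO)
  chartAt := interiorChartOfIsOpen hO
  mem_chart_source := mem_interiorChartOfIsOpen_source hO
  chart_mem_atlas p := mem_range_self p

end Interior


/-! ### Path-connectedness from `H₀` -/

section HZero

variable {A Z : Type u} [TopologicalSpace A] [TopologicalSpace Z]

/-- A space with a clopen subset `C` is the topological sum of `C` and its complement.
[folklore] -/
def homeomorphSumCompl {C : Set Z} (hC : IsClopen C) : (↥C ⊕ ↥Cᶜ) ≃ₜ Z := by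
  classical
  refine (Equiv.Set.sumCompl C).toHomeomorphOfContinuousOpen ?_ ?_
  · rw [continuous_sum_dom]
    constructor
    · have h : ((Equiv.Set.sumCompl C) ∘ Sum.inl : ↥C → Z) = Subtype.val :=
        funext fun x => Equiv.Set.sumCompl_apply_inl C x
      rw [h]
      exact continuous_subtype_val
    · have h : ((Equiv.Set.sumCompl C) ∘ Sum.inr : ↥Cᶜ → Z) = Subtype.val :=
        funext fun x => Equiv.Set.sumCompl_apply_inr C x
      rw [h]
      exact continuous_subtype_val
  · rw [isOpenMap_sum]
    constructor
    · have h : (fun x : ↥C => (Equiv.Set.sumCompl C) (Sum.inl x)) = Subtype.val :=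
        funext fun x => Equiv.Set.sumCompl_apply_inl C x
      rw [h]
      exact hC.isOpen.isOpenMap_subtype_val
    · have h : (fun x : ↥Cᶜ => (Equiv.Set.sumCompl C) (Sum.inr x)) = Subtype.val :=
        funext fun x => Equiv.Set.sumCompl_apply_inr C x
      rw [h]
      exact hC.compl.isOpen.isOpenMap_subtype_val

/-- **A locally path-connected space receiving an `H₀`-surjection from a path-connected space is
path connected** (Hatcher 2002, Prop. 2.6/2.7: `H₀(Z)` is free on the path components, and the
image of `H₀(A) ≅ ℤ` lies in the summand of the component of `f(A)`). Proof: the path component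
`C` of `f(a₀)` is clopen; if `Cᶜ ≠ ∅`, then `Z ≅ C ⊔ Cᶜ`, the image of `f_*` lies in the summand
`H₀(C)` while `H₀(Cᶜ) ≠ 0` (the augmentation is onto `ℤ` there), contradicting surjectivity.
[cite: HatcherAT2002, Prop. 2.6 and Prop. 2.7] -/
theorem pathConnectedSpace_of_surjective_singularHomologyMap_zero [PathConnectedSpace A]
    [LocallyPathConnectedSpace Z] (f : C(A, Z))
    (hf : Function.Surjective (singularHomology.map ℤ ℤ f 0)) : PathConnectedSpace Z := by
  classical
  let a₀ : A := Classical.arbitrary A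
  let C : Set Z := pathComponent (f a₀)
  have hC : IsClopen C := IsClopen.pathComponent _
  have hfC : ∀ a, f a ∈ C := fun a =>
    ⟨(PathConnectedSpace.somePath a₀ a).map f.continuous⟩
  -- it suffices that `C = univ`
  suffices hCu : C = univ by
    rw [pathConnectedSpace_iff_univ, ← hCu]
    exact isPathConnected_pathComponent
  by_contra hne
  obtain ⟨q, hq⟩ : (Cᶜ : Set Z).Nonempty := by
    rw [Set.nonempty_compl]
    exact hne
  let e : (↥C ⊕ ↥Cᶜ) ≃ₜ Z := homeomorphSumCompl hC
  -- `f` factors through the summand `C`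
  let f' : C(A, ↥C) := ⟨fun a => ⟨f a, hfC a⟩, f.continuous.subtype_mk _⟩
  have hfac : (e.symm : C(Z, ↥C ⊕ ↥Cᶜ)).comp f = (SingularSimplex.sumInl ↥C ↥Cᶜ).comp f' := by
    ext a
    show e.symm (f a) = Sum.inl (f' a)
    rw [Homeomorph.symm_apply_eq]
    exact (Equiv.Set.sumCompl_apply_inl C ⟨f a, hfC a⟩).symm
  -- every class of `H₀(C ⊔ Cᶜ)` comes from `H₀(C)`
  have hsurj : ∀ x : singularHomology ℤ ℤ (↥C ⊕ ↥Cᶜ) 0,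
      ∃ y, singularHomology.map ℤ ℤ (SingularSimplex.sumInl ↥C ↥Cᶜ) 0 y = x := by
    intro x
    obtain ⟨w, hw⟩ := (ModuleCat.epi_iff_surjective _).mp
      (inferInstance : Epi (singularHomology.mapIso ℤ ℤ e.symm 0).hom) x
    obtain ⟨v, rfl⟩ := hf w
    refine ⟨singularHomology.map ℤ ℤ f' 0 v, ?_⟩
    rw [← hw, singularHomology.mapIso_hom, ← ModuleCat.comp_apply, ← singularHomology.map_comp,
      ← hfac, singularHomology.map_comp, ModuleCat.comp_apply]
  -- but `H₀(Cᶜ) ≠ 0`: the class of the constant map at `q` has augmentation `≠ 0`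
  let cq : C(A, ↥Cᶜ) := ContinuousMap.const A ⟨q, hq⟩
  haveI := singularHomology.isIso_ε_of_pathConnectedSpace ℤ ℤ (X := A)
  let u : singularHomology ℤ ℤ A 0 := inv (singularHomology.ε ℤ ℤ A) (ULift.up 1)
  have hu : singularHomology.ε ℤ ℤ A u = ULift.up 1 := by
    show (inv (singularHomology.ε ℤ ℤ A) ≫ singularHomology.ε ℤ ℤ A) (ULift.up 1) = ULift.up 1
    rw [IsIso.inv_hom_id]
    rfl
  let bq : singularHomology ℤ ℤ (↥Cᶜ) 0 := singularHomology.map ℤ ℤ cq 0 u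
  have hbq : bq ≠ 0 := by
    intro h
    have h1 : singularHomology.ε ℤ ℤ (↥Cᶜ) bq = ULift.up 1 := by
      show (singularHomology.map ℤ ℤ cq 0 ≫ singularHomology.ε ℤ ℤ (↥Cᶜ)) u = ULift.up 1
      rw [singularHomology.map_ε]
      exact hu
    rw [h, map_zero] at h1
    exact absurd (congrArg ULift.down h1) (by norm_num)
  obtain ⟨y, hy⟩ := hsurj (singularHomology.map ℤ ℤ (SingularSimplex.sumInr ↥C ↥Cᶜ) 0 bq)
  have hzero := (singularHomology.map_inl_add_map_inr_eq_zero_iff 0 y (-bq)).mp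
    (by rw [map_neg, hy, add_neg_cancel])
  exact hbq (neg_eq_zero.mp hzero.2)

end HZero

/-! ### Collars of the two ends of the attached cobordism -/

section Collars

variable {n : ℕ} {W : Type u} [TopologicalSpace W] [ChartedSpace (ℍ (n + 1)) W]
  {b : BoundaryData (𝓡∂ (n + 1)) W (𝓡 n)}
  {N : Type u} [TopologicalSpace N] [ChartedSpace (𝔼 n) N]
  {X : Cobordism n b.carrier N}

/-- The collar map of an `InlOpenCollar` is continuous on `M × [0, ∞)`. [folklore] -/
theorem continuous_inlOpenCollar_unitInterval {M' N' : Type u} [TopologicalSpace M']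
    [ChartedSpace (𝔼 n) M'] [TopologicalSpace N'] [ChartedSpace (𝔼 n) N'] {Y : Cobordism n M' N'}
    (c : Y.InlOpenCollar) : Continuous fun q : M' × I => c.toFun q.1 (q.2 : ℝ) := by
  have h := c.contMDiffOn_toFun.continuousOn
  exact h.comp_continuous (continuous_fst.prodMk (continuous_subtype_val.comp continuous_snd))
    fun q => ⟨mem_univ _, q.2.2.1⟩

/-- **The seam collar**: a long open collar `c` of the incoming end `M = ∂W` of `X`, precomposed
with the gluing diffeomorphism `ψ` and restricted to heights in `[0, 1]`, is a topological
boundary collar of `X` parametrised by `∂W` (`BoundaryCollar`, `CollarPush.lean`) with bottom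
`κ (z, 0) = X.inl (ψ z)`: a closed embedding (`∂W × [0, 1]` is compact, `X` Hausdorff) whose
image of `∂W × [0, 1)`, the part of the collar region of height `< 1`, is open.
[cite: MilnorHCobordism1965, §1 (collar neighbourhood theorem)] -/
def seamCollar [CompactSpace b.carrier] (c : X.InlOpenCollar)
    (ψ : b.carrier ≃ₘ⟮𝓡 n, 𝓡 n⟯ b.carrier) : BoundaryCollar X.W b.carrier where
  collar q := c.toFun (ψ q.1) (q.2 : ℝ)
  isClosedEmbedding_collar := by
    refine Continuous.isClosedEmbedding ?_ ?_
    · exact (continuous_inlOpenCollar_unitInterval c).comp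
        ((ψ.continuous.comp continuous_fst).prodMk continuous_snd)
    · rintro ⟨a, s⟩ ⟨a', s'⟩ h
      obtain ⟨h1, h2⟩ := c.eq_of_apply_eq s.2.1 s'.2.1 h
      exact Prod.ext (ψ.injective h1) (Subtype.ext h2)
  isOpen_image := by
    have hset : (fun q : b.carrier × I => c.toFun (ψ q.1) (q.2 : ℝ)) '' {q | q.2 < 1} =
        c.region ∩ c.height ⁻¹' Iio 1 := by
      ext z
      constructor
      · rintro ⟨q, hq, rfl⟩
        refine ⟨c.mem_region _ _ q.2.2.1, ?_⟩
        rw [mem_preimage, c.height_apply _ _ q.2.2.1]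
        exact hq
      · rintro ⟨hz, hz1⟩
        have h0 := c.height_nonneg z hz
        refine ⟨(ψ.symm (c.proj z), ⟨c.height z, h0, le_of_lt hz1⟩), hz1, ?_⟩
        show c.toFun (ψ (ψ.symm (c.proj z))) (c.height z) = z
        rw [Diffeomorph.apply_symm_apply, c.apply_proj_height z hz]
    rw [hset]
    exact c.contMDiffOn_height.continuousOn.isOpen_inter_preimage c.isOpen_region isOpen_Iio

/-- The seam collar on points. [folklore] -/
@[simp] theorem seamCollar_collar [CompactSpace b.carrier] (c : X.InlOpenCollar)
    (ψ : b.carrier ≃ₘ⟮𝓡 n, 𝓡 n⟯ b.carrier) (q : b.carrier × I) :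
    (seamCollar c ψ).collar q = c.toFun (ψ q.1) (q.2 : ℝ) := rfl

/-- The bottom of the seam collar is `X.inl ∘ ψ`. [folklore] -/
theorem seamCollar_collar_zero [CompactSpace b.carrier] (c : X.InlOpenCollar)
    (ψ : b.carrier ≃ₘ⟮𝓡 n, 𝓡 n⟯ b.carrier) (z : b.carrier) :
    (seamCollar c ψ).collar (z, 0) = X.inl (ψ z) := by
  rw [seamCollar_collar]
  exact c.apply_zero (ψ z)

variable {V : Type u} [TopologicalSpace V] [ChartedSpace (ℍ (n + 1)) V]
  {ψ : b.carrier ≃ₘ⟮𝓡 n, 𝓡 n⟯ b.carrier}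

/-- **`V = W ∪_ψ X` as gluing data**: the attachment `A` exhibits the Hausdorff `V` as the
gluing (`BoundaryCollar.GluingData`, `CollarGluing.lean`) of `W`, along `b.incl : ∂W → W`, with
the collared `X`, along the bottom `z ↦ X.inl (ψ z)` of the seam collar: both pieces are compact,
so `jW`, `jX` are closed embeddings, and the seam relation is the field `jW_eq_jX_iff`.
[cite: MilnorHCobordism1965, §1, Thm. 1.4] -/
def gluingData [CompactSpace W] [T2Space V] [CompactSpace b.carrier]
    (A : CobordismAttachment b X ψ V) (c : X.InlOpenCollar) :
    (seamCollar c ψ).GluingData b.incl V where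
  j₁ := A.jW
  j₂ := A.jX
  isClosedEmbedding_j₁ := A.continuous_jW.isClosedEmbedding A.injective_jW
  isClosedEmbedding_j₂ := A.continuous_jX.isClosedEmbedding A.injective_jX
  range_union_range := A.range_union
  j₁_eq_j₂_iff w x := by
    rw [A.jW_eq_jX_iff]
    simp only [seamCollar_collar_zero]

/-- `jX` maps open sets missing the incoming end to open sets of `V`: the complement of the image
is `jW (W) ∪ jX (Sᶜ)`, a union of two compact sets. [folklore] -/
theorem isOpen_image_jX [CompactSpace W] [T2Space V] (A : CobordismAttachment b X ψ V)
    {S : Set X.W} (hS : IsOpen S) (hdisj : Disjoint S (range X.inl)) : IsOpen (A.jX '' S) := by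
  have hcompl : (A.jX '' S)ᶜ = range A.jW ∪ A.jX '' Sᶜ := by
    ext p
    constructor
    · intro hp
      rcases A.exists_jW_eq_or p with ⟨w, rfl⟩ | ⟨x, rfl⟩
      · exact Or.inl (mem_range_self w)
      · refine Or.inr ⟨x, fun hx => hp ⟨x, hx, rfl⟩, rfl⟩
    · rintro (⟨w, rfl⟩ | ⟨x, hx, rfl⟩) ⟨x', hx', h⟩
      · obtain ⟨z, -, rfl⟩ := (A.jW_eq_jX_iff w x').1 h.symm
        exact Set.disjoint_left.1 hdisj hx' (mem_range_self _)
      · exact hx (A.injective_jX h ▸ hx')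
  rw [← isClosed_compl_iff, hcompl]
  exact (isCompact_range A.continuous_jW).isClosed.union
    ((hS.isClosed_compl.isCompact).image A.continuous_jX).isClosed

/-- **The far-end collar**: a long open collar of the far end `N` of `X` (the incoming end of
`X.symm`), pushed into `V` by `jX` and restricted to heights in `[0, 1]`, is a topological
boundary collar of `V` parametrised by `N` with bottom `κ (y, 0) = jX (X.inr y)`: the collar
region misses the incoming end (`InlOpenCollar.inr_not_mem_region`), where alone `jX` fails to be
open. [cite: MilnorHCobordism1965, §1 (collar neighbourhood theorem)] -/
def farCollar [CompactSpace W] [T2Space V] [CompactSpace N] [IsManifold (𝓡 n) ∞ N]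
    (A : CobordismAttachment b X ψ V) (c : X.symm.InlOpenCollar) : BoundaryCollar V N where
  collar q := A.jX (c.toFun q.1 (q.2 : ℝ))
  isClosedEmbedding_collar := by
    refine Continuous.isClosedEmbedding ?_ ?_
    · exact A.continuous_jX.comp (continuous_inlOpenCollar_unitInterval c)
    · rintro ⟨a, s⟩ ⟨a', s'⟩ h
      obtain ⟨h1, h2⟩ := c.eq_of_apply_eq s.2.1 s'.2.1 (A.injective_jX h)
      exact Prod.ext h1 (Subtype.ext h2)
  isOpen_image := by
    have hset : (fun q : N × I => A.jX (c.toFun q.1 (q.2 : ℝ))) '' {q | q.2 < 1} =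
        A.jX '' (c.region ∩ c.height ⁻¹' Iio 1) := by
      ext p
      constructor
      · rintro ⟨q, hq, rfl⟩
        refine ⟨c.toFun q.1 q.2, ⟨c.mem_region _ _ q.2.2.1, ?_⟩, rfl⟩
        rw [mem_preimage, c.height_apply _ _ q.2.2.1]
        exact hq
      · rintro ⟨z, ⟨hz, hz1⟩, rfl⟩
        have h0 := c.height_nonneg z hz
        refine ⟨(c.proj z, ⟨c.height z, h0, le_of_lt hz1⟩), hz1, ?_⟩
        show A.jX (c.toFun (c.proj z) (c.height z)) = A.jX z
        rw [c.apply_proj_height z hz]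
    rw [hset]
    refine isOpen_image_jX A
      (c.contMDiffOn_height.continuousOn.isOpen_inter_preimage c.isOpen_region isOpen_Iio) ?_
    refine Set.disjoint_left.2 ?_
    rintro z ⟨hz, -⟩ ⟨x, rfl⟩
    exact c.inr_not_mem_region x hz

/-- The far-end collar on points. [folklore] -/
@[simp] theorem farCollar_collar [CompactSpace W] [T2Space V] [CompactSpace N]
    [IsManifold (𝓡 n) ∞ N] (A : CobordismAttachment b X ψ V) (c : X.symm.InlOpenCollar)
    (q : N × I) : (farCollar A c).collar q = A.jX (c.toFun q.1 (q.2 : ℝ)) := rfl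

/-- The bottom of the far-end collar is `jX ∘ X.inr`, i.e. `∂V`. [folklore] -/
theorem farCollar_collar_zero [CompactSpace W] [T2Space V] [CompactSpace N]
    [IsManifold (𝓡 n) ∞ N] (A : CobordismAttachment b X ψ V) (c : X.symm.InlOpenCollar) (y : N) :
    (farCollar A c).collar (y, 0) = A.jX (X.inr y) := by
  have h : c.toFun y ((0 : I) : ℝ) = X.symm.inl y := c.apply_zero y
  exact congrArg A.jX h

/-- **The interior of the far-end collar is the manifold interior of `V`**: its bottom is
`jX (X.inr N) = ∂V`. [folklore] -/
theorem farCollar_interior_eq [CompactSpace W] [T2Space V] [CompactSpace N]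
    [IsManifold (𝓡 n) ∞ N] (A : CobordismAttachment b X ψ V) (c : X.symm.InlOpenCollar) :
    (farCollar A c).interior = (𝓡∂ (n + 1)).interior V := by
  have h : (fun y : N => (farCollar A c).collar (y, 0)) = A.jX ∘ X.inr :=
    funext (farCollar_collar_zero A c)
  rw [BoundaryCollar.interior, h, A.range_jX_comp_inr, ModelWithCorners.compl_boundary]

/-- Hence the manifold interior of `V` is open. [folklore] -/
theorem isOpen_interior_of_cobordismAttachment [CompactSpace W] [T2Space V] [CompactSpace N]
    [IsManifold (𝓡 n) ∞ N] (A : CobordismAttachment b X ψ V) (c : X.symm.InlOpenCollar) :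
    IsOpen ((𝓡∂ (n + 1)).interior V) := by
  rw [← farCollar_interior_eq A c]
  exact (farCollar A c).isOpen_interior

/-- **`V ∖ ∂V ≃ V`**: the interior of `V` is a deformation retract (push along the far-end
collar; Hatcher 2002, Prop. 3.42, `BoundaryCollar.interiorHomotopyEquiv`). [cite: HatcherAT2002, Prop. 3.42] -/
def interiorHomotopyEquivOfCobordismAttachment [CompactSpace W] [T2Space V] [CompactSpace N]
    [IsManifold (𝓡 n) ∞ N] [Nonempty N] (A : CobordismAttachment b X ψ V)
    (c : X.symm.InlOpenCollar) : ↥((𝓡∂ (n + 1)).interior V) ≃ₕ V :=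
  (Homeomorph.setCongr (farCollar_interior_eq A c)).symm.toHomotopyEquiv.trans
    ((farCollar A c).interiorHomotopyEquiv zero_lt_one)

end Collars

/-! ### The gluing is simply connected and acyclic -/

section Topology

variable {n : ℕ} {W : Type u} [TopologicalSpace W] [ChartedSpace (ℍ (n + 1)) W] [CompactSpace W]
  {b : BoundaryData (𝓡∂ (n + 1)) W (𝓡 n)} [CompactSpace b.carrier]
  {N : Type u} [TopologicalSpace N] [ChartedSpace (𝔼 n) N]
  {X : Cobordism n b.carrier N} {ψ : b.carrier ≃ₘ⟮𝓡 n, 𝓡 n⟯ b.carrier}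
  {V : Type u} [TopologicalSpace V] [T2Space V] [ChartedSpace (ℍ (n + 1)) V]

omit [CompactSpace W] in
/-- The bottom of the seam collar, as a continuous map, is `X.inl ∘ ψ`. [folklore] -/
theorem bottom_seamCollar (c : X.InlOpenCollar) (ψ : b.carrier ≃ₘ⟮𝓡 n, 𝓡 n⟯ b.carrier) :
    BoundaryCollar.GluingData.bottom (seamCollar c ψ) =
      (⟨X.inl, X.continuous_inl⟩ : C(b.carrier, X.W)).comp (ψ.toHomeomorph : C(b.carrier, b.carrier)) := by
  ext z
  exact seamCollar_collar_zero c ψ z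

/-- Transport of path homotopies along equal underlying maps with a renamed base point.
[folklore] -/
theorem homotopic_of_coe_eq {Y : Type*} [TopologicalSpace Y] {x x' : Y} (h : x = x')
    {p q : Path x x} {p' q' : Path x' x'} (hp : (p : I → Y) = p') (hq : (q : I → Y) = q')
    (hpq : p.Homotopic q) : p'.Homotopic q' := by
  subst h
  have h1 : p = p' := Path.ext hp
  have h2 : q = q' := Path.ext hq
  subst h1 h2
  exact hpq

omit [CompactSpace W] in
/-- The `π₁`-surjectivity hypothesis transported along `ψ` to the bottom of the seam collar:
every loop of `X` at `κ (a, 0) = X.inl (ψ a)` is homotopic to the image of a loop of `∂W` at `a`.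
[folklore] -/
theorem exists_homotopic_map_bottom_seamCollar (c : X.InlOpenCollar)
    (ψ : b.carrier ≃ₘ⟮𝓡 n, 𝓡 n⟯ b.carrier)
    (hP : ∀ (x : b.carrier) (γ : Path (X.inl x) (X.inl x)),
      ∃ ℓ : Path x x, γ.Homotopic (ℓ.map X.continuous_inl))
    (a : b.carrier) (γ : Path ((seamCollar c ψ).collar (a, 0)) ((seamCollar c ψ).collar (a, 0))) :
    ∃ ℓ : Path a a, γ.Homotopic (ℓ.map (BoundaryCollar.GluingData.bottom (seamCollar c ψ)).continuous) := by
  have h0 : X.inl (ψ a) = (seamCollar c ψ).collar (a, 0) := (seamCollar_collar_zero c ψ a).symm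
  obtain ⟨ℓ, hℓ⟩ := hP (ψ a) (γ.cast h0 h0)
  have ha : ψ.symm (ψ a) = a := ψ.symm_apply_apply a
  refine ⟨(ℓ.map ψ.symm.continuous).cast ha.symm ha.symm, ?_⟩
  refine homotopic_of_coe_eq h0 rfl ?_ hℓ
  funext s
  simp only [Path.map_coe, Function.comp_apply, seamCollar_collar]
  show X.inl (ℓ s) = c.toFun (ψ ((ℓ.map ψ.symm.continuous).cast ha.symm ha.symm s)) ((0 : I) : ℝ)
  rw [Path.cast_coe, Path.map_coe, Function.comp_apply, Diffeomorph.apply_symm_apply]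
  exact (c.apply_zero (ℓ s)).symm

/-- **`W ∪_ψ X` is simply connected** if `W` is contractible, `∂W` and `X` are path connected
and `π₁(∂W) → π₁(X)` is onto at every base point (van Kampen; Akbulut–Ruberman 2016, §3 and
proof of Thm. 5.3: "Since `W` is contractible, and `π₁(M)` [normally] generates `π₁(X)`, it
follows that the `V_j` are all simply-connected"). [cite: AkbulutRuberman2016, §3 and proof of Thm. 5.3] [cite: HatcherAT2002, Thm. 1.20] -/
theorem simplyConnectedSpace_of_cobordismAttachment [ContractibleSpace W]
    [PathConnectedSpace b.carrier] [PathConnectedSpace X.W]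
    (hP : ∀ (x : b.carrier) (γ : Path (X.inl x) (X.inl x)),
      ∃ ℓ : Path x x, γ.Homotopic (ℓ.map X.continuous_inl))
    (A : CobordismAttachment b X ψ V) (c : X.InlOpenCollar) : SimplyConnectedSpace V :=
  (gluingData A c).simplyConnectedSpace (exists_homotopic_map_bottom_seamCollar c ψ hP)

/-- **`W ∪_ψ X` is acyclic** if `W` is contractible and `∂W → X` is an integral homology
isomorphism (Mayer–Vietoris; Akbulut–Ruberman 2016, §3: "`V` and `V′` are … homology balls",
from Lemma 2.3: "`X` is [a] homology cobordism"). [cite: AkbulutRuberman2016, §3 and Lemma 2.3] [cite: HatcherAT2002, §2.2 p. 149] -/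
theorem isZero_singularHomology_of_cobordismAttachment [ContractibleSpace W] [Nonempty b.carrier]
    (hH : ∀ k, IsIso (singularHomology.map ℤ ℤ (⟨X.inl, X.continuous_inl⟩ : C(b.carrier, X.W)) k))
    (A : CobordismAttachment b X ψ V) (c : X.InlOpenCollar) {k : ℕ} (hk : k ≠ 0) :
    IsZero (singularHomology ℤ ℤ V k) := by
  refine (gluingData A c).isZero_singularHomology ℤ ℤ (fun i => ?_) hk
  rw [bottom_seamCollar, singularHomology.map_comp]
  haveI := hH i
  haveI : IsIso (singularHomology.map ℤ ℤ (ψ.toHomeomorph : C(b.carrier, b.carrier)) i) :=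
    (singularHomology.mapIso ℤ ℤ ψ.toHomeomorph i).isIso_hom
  infer_instance

end Topology

/-! ### The gluing is contractible -/

section Contractible

variable {n : ℕ} {W : Type u} [TopologicalSpace W] [ChartedSpace (ℍ (n + 1)) W]
  [IsManifold (𝓡∂ (n + 1)) ∞ W] [CompactSpace W]

/-- **The gluing `W ∪_ψ X` of a compact contractible manifold and a homology cobordism with
`π₁`-surjective near end is contractible** — the sentence "Since `V` and `V′` are simply connected
homology balls, they are contractible" of Akbulut–Ruberman's proof of Thm. A (2016, §3), with the
van Kampen and Mayer–Vietoris computations behind "simply connected homology balls" (from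
Lemma 2.3: `X` a homology cobordism with `π₁(M) → π₁(X)` an isomorphism — surjectivity suffices,
as in the proof of Thm. 5.3) and the Hurewicz–Whitehead recognition of contractible manifolds
(Bredon 1993, VII Cor. 10.11) all PROVED. Hypotheses: `W` compact contractible smooth with
boundary datum `b` and connected boundary `∂W`; `N` compact nonempty; `X` a cobordism from `∂W` to
`N` with `X.inl` an isomorphism on all `Hₖ(-; ℤ)` and every loop of `X` at a point `X.inl x`
homotopic to the image of a loop of `∂W` at `x`; `ψ` any self-diffeomorphism of `∂W`;
`V` any Hausdorff manifold-with-boundary witness of `W ∪_ψ X` (`CobordismAttachment`). Proof: §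
"Proof of `contractibleSpace_of_cobordismAttachment`" of the module docstring.
[cite: AkbulutRuberman2016, §3, proof of Thm. A ("simply connected homology balls … contractible") and Lemma 2.3] [cite: Bredon1993, Ch. VII Cor. 10.11] -/
theorem contractibleSpace_of_cobordismAttachment [ContractibleSpace W]
    (b : BoundaryData (𝓡∂ (n + 1)) W (𝓡 n)) [ConnectedSpace b.carrier]
    {N : Type u} [TopologicalSpace N] [ChartedSpace (𝔼 n) N] [IsManifold (𝓡 n) ∞ N]
    [CompactSpace N] [Nonempty N] (X : Cobordism n b.carrier N)
    (hH : ∀ k, IsIso (singularHomology.map ℤ ℤ (⟨X.inl, X.continuous_inl⟩ : C(b.carrier, X.W)) k))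
    (hP : ∀ (x : b.carrier) (γ : Path (X.inl x) (X.inl x)),
      ∃ ℓ : Path x x, γ.Homotopic (ℓ.map X.continuous_inl))
    (ψ : b.carrier ≃ₘ⟮𝓡 n, 𝓡 n⟯ b.carrier) {V : Type u} [TopologicalSpace V] [T2Space V]
    [ChartedSpace (ℍ (n + 1)) V] (A : CobordismAttachment b X ψ V) : ContractibleSpace V := by
  -- compactness and path connectedness of the pieces (`X` is path connected as `H₀(∂W) → H₀(X)`
  -- is onto)
  haveI : CompactSpace b.carrier := b.compactSpace_carrier
  haveI : LocallyPathConnectedSpace b.carrier :=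
    ChartedSpace.locallyPathConnectedSpace (𝔼 n) b.carrier
  haveI : PathConnectedSpace b.carrier := pathConnectedSpace_iff_connectedSpace.2 inferInstance
  haveI : LocallyPathConnectedSpace X.W := ChartedSpace.locallyPathConnectedSpace (ℍ (n + 1)) X.W
  haveI : PathConnectedSpace X.W :=
    pathConnectedSpace_of_surjective_singularHomologyMap_zero
      (⟨X.inl, X.continuous_inl⟩ : C(b.carrier, X.W))
      ((ModuleCat.epi_iff_surjective _).mp (by haveI := hH 0; infer_instance))
  haveI : CompactSpace V := A.compactSpace
  -- collars of the two ends of `X`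
  obtain ⟨c⟩ := X.nonempty_inlOpenCollar
  obtain ⟨c'⟩ := X.symm.nonempty_inlOpenCollar
  -- `V` is simply connected and acyclic
  haveI hsc : SimplyConnectedSpace V := simplyConnectedSpace_of_cobordismAttachment hP A c
  have hac : ∀ k, k ≠ 0 → IsZero (singularHomology ℤ ℤ V k) := fun k hk =>
    isZero_singularHomology_of_cobordismAttachment hH A c hk
  -- the interior of `V`: open, a deformation retract, a boundaryless manifold
  have hO : IsOpen ((𝓡∂ (n + 1)).interior V) := isOpen_interior_of_cobordismAttachment A c'
  let e : ↥((𝓡∂ (n + 1)).interior V) ≃ₕ V := interiorHomotopyEquivOfCobordismAttachment A c'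
  letI : ChartedSpace (𝔼 (n + 1)) ↥((𝓡∂ (n + 1)).interior V) := interiorChartedSpace hO
  haveI : SecondCountableTopology (ℍ (n + 1)) := TopologicalSpace.Subtype.secondCountableTopology _
  haveI : SecondCountableTopology V :=
    ChartedSpace.secondCountable_of_sigmaCompact (ℍ (n + 1)) V
  haveI : SimplyConnectedSpace ↥((𝓡∂ (n + 1)).interior V) := e.simplyConnectedSpace_iff.2 hsc
  have hac' : ∀ k : ℕ, 1 ≤ k → IsZero (singularHomology ℤ ℤ ↥((𝓡∂ (n + 1)).interior V) k) :=
    fun k hk => (hac k (by omega)).of_iso (singularHomology.isoOfHomotopyEquiv ℤ ℤ e k)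
  haveI : ContractibleSpace ↥((𝓡∂ (n + 1)).interior V) :=
    Manifold.contractibleSpace_of_simplyConnected_of_acyclic_holds (n + 1) _ hac'
  exact e.symm.contractibleSpace

/-- `contractibleSpace_of_cobordismAttachment` with the `π₁`-surjectivity hypothesis phrased
through Mathlib's `FundamentalGroup.map`. [cite: AkbulutRuberman2016, §3, proof of Thm. A and Lemma 2.3] -/
theorem contractibleSpace_of_cobordismAttachment_of_surjective [ContractibleSpace W]
    (b : BoundaryData (𝓡∂ (n + 1)) W (𝓡 n)) [ConnectedSpace b.carrier]
    {N : Type u} [TopologicalSpace N] [ChartedSpace (𝔼 n) N] [IsManifold (𝓡 n) ∞ N]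
    [CompactSpace N] [Nonempty N] (X : Cobordism n b.carrier N)
    (hH : ∀ k, IsIso (singularHomology.map ℤ ℤ (⟨X.inl, X.continuous_inl⟩ : C(b.carrier, X.W)) k))
    (hP : ∀ x : b.carrier, Function.Surjective
      (FundamentalGroup.map (⟨X.inl, X.continuous_inl⟩ : C(b.carrier, X.W)) x))
    (ψ : b.carrier ≃ₘ⟮𝓡 n, 𝓡 n⟯ b.carrier) {V : Type u} [TopologicalSpace V] [T2Space V]
    [ChartedSpace (ℍ (n + 1)) V] (A : CobordismAttachment b X ψ V) : ContractibleSpace V :=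
  contractibleSpace_of_cobordismAttachment b X hH
    (fun x γ => exists_homotopic_map_of_surjective_fundamentalGroupMap _ x (hP x) γ) ψ A

end Contractible

/-! ### The named fact from its geometric core -/

/-- **Akbulut–Ruberman's symmetry-killing cobordism (named fact
`akbulutRuberman2016_symmetryKillingCobordism`) from its geometric core.** The hypothesis is the
output of the 3-manifold topology of the printed proof, stated inline: for every compact
contractible smooth 4-manifold `W` with boundary datum `b`, (a) `∂W` is connected (it is an
integral homology 3-sphere by Poincaré–Lefschetz duality; for Thm. B, `∂W` is the boundary of a
cork), and (b) there are a CLOSED (`CompactSpace`, `Nonempty`) 3-manifold `N` and a cobordism `X`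
from `∂W` to `N` which is invertible (Lemma 2.3), has the extension property of the Claim of §3
(`FarEndDiffeosExtend`), and whose near end `∂W → X` is an isomorphism on integral homology
(Lemma 2.3: "`X` is an invertible homology cobordism") and onto on `π₁` (Lemma 2.3: "the
inclusion `M → X` induces an isomorphism on fundamental groups"). The conclusion (iii) of the
named fact — every `W ∪_ψ X` is contractible ("simply connected homology balls … are
contractible", §3) — is then `contractibleSpace_of_cobordismAttachment_of_surjective`; (i) and
(ii) are passed through. No new named fact is introduced (D-0026): what remains unproved of
`akbulutRuberman2016_symmetryKillingCobordism` is exactly this inline hypothesis (Lemma 2.3 with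
Cor. 2.5, Prop. 2.6 and the Claim: hyperbolic links with trivial symmetry group, the doubly slice
knot `11n42`, JSJ decompositions — no vocabulary in Mathlib or the tree — and the duality
statement (a)). [cite: AkbulutRuberman2016, §3 (proof of Thm. A, first paragraph and Claim) and Lemma 2.3] -/
theorem akbulutRuberman2016_symmetryKillingCobordism_of_core
    (hcore : ∀ (W : Type u) [TopologicalSpace W] [T2Space W] [SecondCountableTopology W]
      [ChartedSpace (ℍ 4) W] [IsManifold (𝓡∂ 4) ∞ W] [CompactSpace W] [ContractibleSpace W]
      (b : BoundaryData (𝓡∂ 4) W (𝓡 3)),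
      ConnectedSpace b.carrier ∧
      ∃ (N : Type u) (_ : TopologicalSpace N) (_ : ChartedSpace (𝔼 3) N) (_ : IsManifold (𝓡 3) ∞ N)
        (_ : CompactSpace N) (_ : Nonempty N) (X : Cobordism 3 b.carrier N),
        X.IsInvertible ∧ FarEndDiffeosExtend X ∧
        (∀ k, IsIso (singularHomology.map ℤ ℤ (⟨X.inl, X.continuous_inl⟩ : C(b.carrier, X.W)) k)) ∧
        (∀ x : b.carrier, Function.Surjective
          (FundamentalGroup.map (⟨X.inl, X.continuous_inl⟩ : C(b.carrier, X.W)) x))) :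
    akbulutRuberman2016_symmetryKillingCobordism.{u} := by
  intro W _ _ _ _ _ _ _ b
  obtain ⟨hconn, N, _, _, _, _, _, X, hInv, hFar, hH, hP⟩ := hcore W b
  haveI := hconn
  refine ⟨N, ‹_›, ‹_›, ‹_›, X, hInv, hFar, fun ψ V _ _ _ hA => ?_⟩
  obtain ⟨A⟩ := hA
  exact contractibleSpace_of_cobordismAttachment_of_surjective b X hH hP ψ A

end Literature.Barriers.SmoothPoincare4

end
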